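import Summits.BirchSwinnertonDyer.Rank1Residual.Additive.GordHigherCongruentPairGVShift
import Summits.BirchSwinnertonDyer.Rank1Residual.Additive.GordCongruentPairGVBudget
import Summits.BirchSwinnertonDyer.Rank1Residual.Additive.TorsionOrderOfTorsionIso
import HarnessLib

/-!
# Route-G BUDGETS `BudgetLeLambdaAt p E b` on (G-ord) receivers of ANY semistability defect
# (`e ∈ {3,4,6}` included) from a GV congruent partner of defect 2 — (G-ord, `e = 2`) or (M) —
# EPW-free, partner in the weak currency and in RANK currency, `p ≥ 5`, off the swap locus, modulo
# the receiver's R-D identification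
# (cell `b2b-bsdres`, team n1011, seat p07 (gen 7); row T-ROL-EXP FILE E; the e346-receiver twins of
# p07-g6's `GordCongruentPairGVBudget` (T-E3d-GV FILE 4))

HONEST FRAMING (cell `b2b-bsdres`, run/shared/lean/b2b/bsd-rank1-residual/, verbatim in every
file): the goal of the cell is to DELETE the COMBINATION-SHAPED residual classes of the
Birch–Swinnerton-Dyer formula for ALL analytic-rank `≤ 1` elliptic curves over `ℚ` — "full BSD
formula for every rank `≤ 1` curve in class `C`" assembled STRICTLY from published theorems — so
that the rank-`≤ 1` remainder becomes exactly the CONSTRUCTION-SHAPED classes, which are TYPED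
(missing-input `Prop`s), NOT attempted. This is not "finishing BSD". Team n1011 (N10/N11, (G-ord)
rows of every defect): research route; labels and marks UNCHANGED; nothing booked. TOOL theorems only:
NO definition, NO named fact. CONDITIONAL on the tree's EXISTING named facts exactly as the consumed
files (`hGV` A240, `hGrK` A239, `hT40`/`hT41` A40/A41, `hK` Kato 17.4 (3), `hW16` Wuthrich Thm. 16,
`hmodD`); the receiver's R-D identification `RamifiedLineKummerEqAt W p` is an EXPLICIT binder on its
`e ∈ {3,4,6}` rows (T-RD-E346, not in the tree).

## What and why

Route G's budget node `BudgetLeLambdaAt p E b` (p10) is fed per pair by a congruent partner through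
`CongruentLambdaShift` + the `μ = 0` transfer + a partner datum (torsion ∧ (μ = 0 → r₁ ≤ λ)) — p07-g6's
schema lemma `budgetLeLambdaAt_of_congruentLambdaShift_of_muTransfer`. On (G-ord, `e = 2`) and (M)
receivers this is T-E3d-GV (p279735 … p284976). This file puts the RECEIVER on a (G-ord) row of ANY
defect (`p ≥ 5`, off the swap locus `(p−1) ∣ lcm(e, 2)`), the λ-shift and μ transfer being row
T-ROL-EXP FILE D2 (`GordHigherCongruentPairGVShift`); partners of defect 2 keep their certificate-free
inputs (g5 `ClassX4Gord.isTorsion_and_le_lambdaInvariant_of_katoHalf`, g3 `ClassX4M.…_of_katoHalf`,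
g6 `ClassX3Gord/ClassX3M.…_of_wuthrichHalf`).

* §1 weak currency: `ClassX4Gord.budgetLeLambdaAt_of_gv_of_gordTwoPartner_of_congr_of_not_dvd_lcm`,
  `…_of_multPartner_of_congr_of_not_dvd_lcm`, and the X3♯(G-ord) receivers (one census torsion bit);
* §2 RANK currency: the same four with `h₁` discharged (partner `ρ̄` onto + `r₁ ≤ rank E₁(ℚ)` on X4,
  `r₁ ≤ rank E₁(ℚ)` alone on X3).

NOT here: rank-0 / rank-1 ENDs on e346 receivers — their Kato-direction input (`CycLeadingTermAt` for
the nebentypus form `f̃`) is CONSTRUCTION-SHAPED (class file N10 §5; r2 ST-25.x); the swap locus;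
`p = 3`; e346 PARTNERS (their `h₁` input has no certificate-free supplier in the tree).

References: R. Greenberg, V. Vatsal, Invent. Math. 142 (2000) §2 Prop. (2.8), Remark (2.9), Cor. (2.3),
Prop. (2.4), pp. 26–27 [GreenbergVatsal2000]; K. Kato, Astérisque 295 (2004) Thm. 17.4 (3)
[Kato2004Asterisque]; C. Wuthrich, J. London Math. Soc. 89 (2014) Thm. 16 [Wuthrich2014];
R. Greenberg, LNM 1716 (1999) Prop. 2.4, Prop. 4.14 [GreenbergLNM1716]; cells/n1011/skel/T-ROL-EXP.md
(67779f27699eb635); ROUTE-2 II.12 / II.25 (r2).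
-/

set_option autoImplicit false

noncomputable section

open scoped Classical MatrixGroups ModularForm NumberField

open CongruenceSubgroup WeierstrassCurve NumberField IsDedekindDomain Field
  Literature.NumberTheory.EllipticCurves
  Literature.NumberTheory.EllipticCurves.ModularForms
  Literature.NumberTheory.EllipticCurves.Rank1Residual
  Literature.NumberTheory.EllipticCurves.Rank1Residual.Typed
  Literature.NumberTheory.EllipticCurves.GreenbergSelmer
  Literature.NumberTheory.EllipticCurves.Greenberg1999
  Literature.NumberTheory.EllipticCurves.Wuthrich2014
  Literature.NumberTheory.EllipticCurves.GreenbergVatsal2000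
  Literature.NumberTheory.GaloisRepresentations
  Summit.BirchSwinnertonDyer.Rank1Residual.X1.MuLambda
  Summit.BirchSwinnertonDyer.Rank1Residual.X11a
  Summit.BirchSwinnertonDyer.Rank1Residual.Iwasawa

open Summit.BirchSwinnertonDyer.Rank1Residual.X1.CongruenceTransfer (TorsionIso CongruentLambdaShift)

namespace Summit.BirchSwinnertonDyer.Rank1Residual.Additive

open Summit.BirchSwinnertonDyer.Rank1Residual.AdditivePotMult
open GordHigherCongruentPairGVShift
open Summit.BirchSwinnertonDyer.Rank1Residual.AdditivePotMult.GordHigherCongruentPairGVShift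

variable {W W₁ : WeierstrassCurve ℚ} [W.IsElliptic] [W.IsGloballyMinimal] [W₁.IsElliptic]
  [W₁.IsGloballyMinimal] {p : ℕ} [hp : Fact p.Prime]

/-! ### §1 (G-ord) receivers of ANY defect, partner in the weak currency -/

/-- **X4♯(G-ord) receiver of ANY defect `e`, X4♯(G-ord) ∩ `I₀*` partner (`p ≥ 5`,
`(p−1) ∤ lcm(e, 2)`): the EPW-free Route-G budget from the GV record.** Given `hGV` (A240), `hGrK`
(A239, the partner's R-D), the receiver's R-D `hRD` (binder), a `TorsionIso` certificate, `Σ₀`, and a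
partner datum in the WEAK currency `D₁ torsion ∧ (μ(D₁) = 0 → r₁ ≤ λ(D₁))` (the partner's `μ = 0` is
TRANSFERRED from the receiver by FILE D2): `BudgetLeLambdaAt p E b` for `b ≤ r₁ + Σ(δ(E₁) − δ(E))`.
The e346-receiver twin of g6's `ClassX4Gord.budgetLeLambdaAt_of_gv_of_gordPartner_of_congr`. PER PAIR;
X4♯(G-ord) stays CONSTRUCTION-SHAPED; nothing booked.
[cite: GreenbergVatsal2000, §2 Prop. (2.8) with Remark (2.9), Cor. (2.3), Prop. (2.4), pp. 26–27 (arXiv:math/9906215)]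
[cite: GreenbergLNM1716, §2 Props. 2.2, 2.4, §3 Lemma 3.1] -/
theorem ClassX4Gord.budgetLeLambdaAt_of_gv_of_gordTwoPartner_of_congr_of_not_dvd_lcm
    (hGV : muLambdaAlg_transfer_of_torsionIso_potOrd_of_not_dvd_torsionOrder)
    (hGrK : imKummer_ge_strictCondition_goodOrdinary) (hp5 : 5 ≤ p)
    (hX : ClassX4Gord W p) (hRD : RamifiedLineKummerEqAt W p)
    (hX₁ : ClassX4Gord W₁ p) (he₁ : semistabilityIndex W₁ p = 2)
    (hlcm : ¬ (p - 1) ∣ Nat.lcm (semistabilityIndex W p) 2) (hT : TorsionIso W W₁ p)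
    (S₀ : Finset (HeightOneSpectrum (𝓞 ℚ))) (hS₀ : ∀ w ∈ S₀, ((p : ℕ) : 𝓞 ℚ) ∉ w.asIdeal)
    (hS : ∀ w : HeightOneSpectrum (𝓞 ℚ), w ∉ S₀ → ((p : ℕ) : 𝓞 ℚ) ∉ w.asIdeal →
      W.HasGoodReductionAt w)
    (hS₁ : ∀ w : HeightOneSpectrum (𝓞 ℚ), w ∉ S₀ → ((p : ℕ) : 𝓞 ℚ) ∉ w.asIdeal →
      W₁.HasGoodReductionAt w)
    {r₁ : ℕ}
    (h₁ : ∀ {κ : ZpExtension ℚ p} {γ : absoluteGaloisGroup ℚ},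
      κ.IsCyclotomic → κ.IsTopGenerator γ → IsCyclotomicVariable p γ →
      ∀ (D₁ : W₁.SelmerDualData κ γ) [Module.Finite (IwasawaAlgebra p) D₁.X],
        D₁.IsTorsion ∧ (D₁.mu = 0 → r₁ ≤ lambdaInvariant p D₁.X))
    {b : ℕ} (hb : (b : ℤ) ≤ r₁ + ∑ w ∈ S₀, ((delta W₁ p w : ℤ) - (delta W p w : ℤ))) :
    BudgetLeLambdaAt p W b :=
  have hlcm' : ¬ (p - 1) ∣ Nat.lcm (semistabilityIndex W p) (semistabilityIndex W₁ p) := by rwa [he₁]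
  have hRD₁ : RamifiedLineKummerEqAt W₁ p :=
    AdditivePotMult.ramifiedLineKummerEqAt_of_typeGOrd hGrK (by omega) hX₁.typeGOrd hX₁.addv.2 he₁
  budgetLeLambdaAt_of_congruentLambdaShift_of_muTransfer hT
    (congruentLambdaShift_of_gv_of_typeGOrd_typeGOrd_of_not_dvd_lcm hGV hp5 hX.typeGOrd hX.addv.2
      hX₁.typeGOrd hX₁.addv.2 hlcm' hX.not_dvd_torsionOrder hX₁.not_dvd_torsionOrder hRD hRD₁ hT S₀ hS₀
      hS hS₁)
    (fun hκ hγ hγ' D D₁ _ _ hXt hX₁t hmu ↦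
      mu_eq_zero_of_gv_of_typeGOrd_typeGOrd_of_not_dvd_lcm hGV hp5 hX.typeGOrd hX.addv.2 hX₁.typeGOrd
        hX₁.addv.2 hlcm' hX.not_dvd_torsionOrder hX₁.not_dvd_torsionOrder hRD hRD₁ hT S₀ hS₀ hS hS₁ hκ
        hγ hγ' D D₁ hXt hX₁t hmu)
    h₁ hb

/-- **X4♯(G-ord) receiver of ANY defect, X4(M) partner (`p ≥ 5`, `(p−1) ∤ lcm(e, 2)`): the EPW-free
Route-G budget from the GV record**, mod A40/A41 (the partner's R-D) + the receiver's `hRD`; partner in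
the weak currency. PER PAIR; nothing booked.
[cite: GreenbergVatsal2000, §2 Prop. (2.8) with Remark (2.9), Cor. (2.3), Prop. (2.4), pp. 26–27 (arXiv:math/9906215)]
[cite: SilvermanATAEC1994, Ch. V Thm. 5.3, Cor. 5.4] -/
theorem ClassX4Gord.budgetLeLambdaAt_of_gv_of_multPartner_of_congr_of_not_dvd_lcm
    (hGV : muLambdaAlg_transfer_of_torsionIso_potOrd_of_not_dvd_torsionOrder)
    (hT40 : Silverman1994_thmV53_tateUniformisation.{0})
    (hT41 : Silverman1994_thmV53_corV54_tateUniformisation.{0}) (hp5 : 5 ≤ p)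
    (hX : ClassX4Gord W p) (hRD : RamifiedLineKummerEqAt W p) (hX₁ : ClassX4M W₁ p)
    (hlcm : ¬ (p - 1) ∣ Nat.lcm (semistabilityIndex W p) 2) (hT : TorsionIso W W₁ p)
    (S₀ : Finset (HeightOneSpectrum (𝓞 ℚ))) (hS₀ : ∀ w ∈ S₀, ((p : ℕ) : 𝓞 ℚ) ∉ w.asIdeal)
    (hS : ∀ w : HeightOneSpectrum (𝓞 ℚ), w ∉ S₀ → ((p : ℕ) : 𝓞 ℚ) ∉ w.asIdeal →
      W.HasGoodReductionAt w)
    (hS₁ : ∀ w : HeightOneSpectrum (𝓞 ℚ), w ∉ S₀ → ((p : ℕ) : 𝓞 ℚ) ∉ w.asIdeal →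
      W₁.HasGoodReductionAt w)
    {r₁ : ℕ}
    (h₁ : ∀ {κ : ZpExtension ℚ p} {γ : absoluteGaloisGroup ℚ},
      κ.IsCyclotomic → κ.IsTopGenerator γ → IsCyclotomicVariable p γ →
      ∀ (D₁ : W₁.SelmerDualData κ γ) [Module.Finite (IwasawaAlgebra p) D₁.X],
        D₁.IsTorsion ∧ (D₁.mu = 0 → r₁ ≤ lambdaInvariant p D₁.X))
    {b : ℕ} (hb : (b : ℤ) ≤ r₁ + ∑ w ∈ S₀, ((delta W₁ p w : ℤ) - (delta W p w : ℤ))) :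
    BudgetLeLambdaAt p W b :=
  budgetLeLambdaAt_of_congruentLambdaShift_of_muTransfer hT
    (congruentLambdaShift_of_gv_of_typeGOrd_potMult_of_not_dvd_lcm hGV hT40 hT41 hp5 hX.typeGOrd
      hX.addv.2 (ClassX4M.potMult W₁ p hX₁) hlcm hX.not_dvd_torsionOrder hX₁.not_dvd_torsionOrder hRD hT
      S₀ hS₀ hS hS₁)
    (fun hκ hγ hγ' D D₁ _ _ hXt hX₁t hmu ↦
      mu_eq_zero_of_gv_of_typeGOrd_potMult_of_not_dvd_lcm hGV hT40 hT41 hp5 hX.typeGOrd hX.addv.2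
        (ClassX4M.potMult W₁ p hX₁) hlcm hX.not_dvd_torsionOrder hX₁.not_dvd_torsionOrder hRD hT S₀ hS₀
        hS hS₁ hκ hγ hγ' D D₁ hXt hX₁t hmu)
    h₁ hb

/-- **X3♯(G-ord) receiver of ANY defect, X3♯(G-ord) ∩ `I₀*` partner (`p ≥ 5`, `(p−1) ∤ lcm(e, 2)`) —
ONE census torsion bit `p ∤ #E(ℚ)_tors` (the partner's follows from the congruence, cc-typer-2's
`not_dvd_torsionOrder_of_torsionIso`); partner in the weak currency; mod `hGV`, `hGrK`, the receiver's
`hRD`.** PER PAIR; X3♯(G-ord) stays CONSTRUCTION-SHAPED; nothing booked.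
[cite: GreenbergVatsal2000, §2 Prop. (2.8) with Remark (2.9), Cor. (2.3), Prop. (2.4), pp. 26–27 (arXiv:math/9906215)]
[cite: GreenbergLNM1716, Prop. 4.14, §2 Props. 2.2, 2.4] -/
theorem ClassX3Gord.budgetLeLambdaAt_of_gv_of_gordTwoPartner_of_congr_of_not_dvd_lcm
    (hGV : muLambdaAlg_transfer_of_torsionIso_potOrd_of_not_dvd_torsionOrder)
    (hGrK : imKummer_ge_strictCondition_goodOrdinary) (hp5 : 5 ≤ p)
    (hX : ClassX3Gord W p) (hRD : RamifiedLineKummerEqAt W p)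
    (hX₁ : ClassX3Gord W₁ p) (he₁ : semistabilityIndex W₁ p = 2)
    (hlcm : ¬ (p - 1) ∣ Nat.lcm (semistabilityIndex W p) 2) (htors : ¬ p ∣ W.torsionOrder)
    (hT : TorsionIso W W₁ p)
    (S₀ : Finset (HeightOneSpectrum (𝓞 ℚ))) (hS₀ : ∀ w ∈ S₀, ((p : ℕ) : 𝓞 ℚ) ∉ w.asIdeal)
    (hS : ∀ w : HeightOneSpectrum (𝓞 ℚ), w ∉ S₀ → ((p : ℕ) : 𝓞 ℚ) ∉ w.asIdeal →
      W.HasGoodReductionAt w)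
    (hS₁ : ∀ w : HeightOneSpectrum (𝓞 ℚ), w ∉ S₀ → ((p : ℕ) : 𝓞 ℚ) ∉ w.asIdeal →
      W₁.HasGoodReductionAt w)
    {r₁ : ℕ}
    (h₁ : ∀ {κ : ZpExtension ℚ p} {γ : absoluteGaloisGroup ℚ},
      κ.IsCyclotomic → κ.IsTopGenerator γ → IsCyclotomicVariable p γ →
      ∀ (D₁ : W₁.SelmerDualData κ γ) [Module.Finite (IwasawaAlgebra p) D₁.X],
        D₁.IsTorsion ∧ (D₁.mu = 0 → r₁ ≤ lambdaInvariant p D₁.X))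
    {b : ℕ} (hb : (b : ℤ) ≤ r₁ + ∑ w ∈ S₀, ((delta W₁ p w : ℤ) - (delta W p w : ℤ))) :
    BudgetLeLambdaAt p W b :=
  have hlcm' : ¬ (p - 1) ∣ Nat.lcm (semistabilityIndex W p) (semistabilityIndex W₁ p) := by rwa [he₁]
  have hRD₁ : RamifiedLineKummerEqAt W₁ p :=
    AdditivePotMult.ramifiedLineKummerEqAt_of_typeGOrd hGrK (by omega) hX₁.typeGOrd hX₁.addv he₁
  have htors₁ : ¬ p ∣ W₁.torsionOrder := not_dvd_torsionOrder_of_torsionIso hT htors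
  budgetLeLambdaAt_of_congruentLambdaShift_of_muTransfer hT
    (congruentLambdaShift_of_gv_of_typeGOrd_typeGOrd_of_not_dvd_lcm hGV hp5 hX.typeGOrd hX.addv
      hX₁.typeGOrd hX₁.addv hlcm' htors htors₁ hRD hRD₁ hT S₀ hS₀ hS hS₁)
    (fun hκ hγ hγ' D D₁ _ _ hXt hX₁t hmu ↦
      mu_eq_zero_of_gv_of_typeGOrd_typeGOrd_of_not_dvd_lcm hGV hp5 hX.typeGOrd hX.addv hX₁.typeGOrd
        hX₁.addv hlcm' htors htors₁ hRD hRD₁ hT S₀ hS₀ hS hS₁ hκ hγ hγ' D D₁ hXt hX₁t hmu)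
    h₁ hb

/-- **X3♯(G-ord) receiver of ANY defect, X3♯(M) partner (`p ≥ 5`, `(p−1) ∤ lcm(e, 2)`) — one census
torsion bit; partner in the weak currency; mod `hGV`, A40/A41, the receiver's `hRD`.** PER PAIR;
nothing booked. [cite: GreenbergVatsal2000, §2 Prop. (2.8) with Remark (2.9), Cor. (2.3), Prop. (2.4), pp. 26–27 (arXiv:math/9906215)]
[cite: SilvermanATAEC1994, Ch. V Thm. 5.3, Cor. 5.4] -/
theorem ClassX3Gord.budgetLeLambdaAt_of_gv_of_multPartner_of_congr_of_not_dvd_lcm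
    (hGV : muLambdaAlg_transfer_of_torsionIso_potOrd_of_not_dvd_torsionOrder)
    (hT40 : Silverman1994_thmV53_tateUniformisation.{0})
    (hT41 : Silverman1994_thmV53_corV54_tateUniformisation.{0}) (hp5 : 5 ≤ p)
    (hX : ClassX3Gord W p) (hRD : RamifiedLineKummerEqAt W p) (hX₁ : ClassX3M W₁ p)
    (hlcm : ¬ (p - 1) ∣ Nat.lcm (semistabilityIndex W p) 2) (htors : ¬ p ∣ W.torsionOrder)
    (hT : TorsionIso W W₁ p)
    (S₀ : Finset (HeightOneSpectrum (𝓞 ℚ))) (hS₀ : ∀ w ∈ S₀, ((p : ℕ) : 𝓞 ℚ) ∉ w.asIdeal)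
    (hS : ∀ w : HeightOneSpectrum (𝓞 ℚ), w ∉ S₀ → ((p : ℕ) : 𝓞 ℚ) ∉ w.asIdeal →
      W.HasGoodReductionAt w)
    (hS₁ : ∀ w : HeightOneSpectrum (𝓞 ℚ), w ∉ S₀ → ((p : ℕ) : 𝓞 ℚ) ∉ w.asIdeal →
      W₁.HasGoodReductionAt w)
    {r₁ : ℕ}
    (h₁ : ∀ {κ : ZpExtension ℚ p} {γ : absoluteGaloisGroup ℚ},
      κ.IsCyclotomic → κ.IsTopGenerator γ → IsCyclotomicVariable p γ →
      ∀ (D₁ : W₁.SelmerDualData κ γ) [Module.Finite (IwasawaAlgebra p) D₁.X],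
        D₁.IsTorsion ∧ (D₁.mu = 0 → r₁ ≤ lambdaInvariant p D₁.X))
    {b : ℕ} (hb : (b : ℤ) ≤ r₁ + ∑ w ∈ S₀, ((delta W₁ p w : ℤ) - (delta W p w : ℤ))) :
    BudgetLeLambdaAt p W b :=
  have htors₁ : ¬ p ∣ W₁.torsionOrder := not_dvd_torsionOrder_of_torsionIso hT htors
  budgetLeLambdaAt_of_congruentLambdaShift_of_muTransfer hT
    (congruentLambdaShift_of_gv_of_typeGOrd_potMult_of_not_dvd_lcm hGV hT40 hT41 hp5 hX.typeGOrd
      hX.addv (ClassX3M.potMult W₁ p hX₁) hlcm htors htors₁ hRD hT S₀ hS₀ hS hS₁)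
    (fun hκ hγ hγ' D D₁ _ _ hXt hX₁t hmu ↦
      mu_eq_zero_of_gv_of_typeGOrd_potMult_of_not_dvd_lcm hGV hT40 hT41 hp5 hX.typeGOrd hX.addv
        (ClassX3M.potMult W₁ p hX₁) hlcm htors htors₁ hRD hT S₀ hS₀ hS hS₁ hκ hγ hγ' D D₁ hXt hX₁t hmu)
    h₁ hb

/-! ### §2 (G-ord) receivers of ANY defect, partner in RANK currency -/

/-- **X4♯(G-ord) receiver of ANY defect, X4♯(G-ord) ∩ `I₀*` ∧ surj(p) partner of rank `≥ r₁`
(`p ≥ 5`, off the swap locus): the EPW-free Route-G budget** from `hGV`, `hGrK`, `hK`, `hmodD`, the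
receiver's `hRD`, a `TorsionIso` certificate, `Σ₀`, `ρ̄_{E₁,p}` onto, `r₁ ≤ rank E₁(ℚ)` (§1 + g5's
`ClassX4Gord.isTorsion_and_le_lambdaInvariant_of_katoHalf`). PER PAIR; nothing booked.
[cite: GreenbergVatsal2000, §2 Prop. (2.8) with Remark (2.9), Cor. (2.3), Prop. (2.4), pp. 26–27 (arXiv:math/9906215)]
[cite: Kato2004Asterisque, Thm. 17.4 (3) (p. 273)] [cite: GreenbergLNM1716, §2 Props. 2.2, 2.4, §3 Lemma 3.1] -/
theorem ClassX4Gord.budgetLeLambdaAt_of_gv_of_gordTwoPartner_of_rank_of_not_dvd_lcm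
    (hGV : muLambdaAlg_transfer_of_torsionIso_potOrd_of_not_dvd_torsionOrder)
    (hGrK : imKummer_ge_strictCondition_goodOrdinary)
    (hK : Wuthrich2014.kato_halfEigenCharIdeal_dvd_cyclotomicPrime_of_surjective)
    (hmodD : nonempty_modularParametrizationData) (hp5 : 5 ≤ p)
    (hX : ClassX4Gord W p) (hRD : RamifiedLineKummerEqAt W p)
    (hX₁ : ClassX4Gord W₁ p) (he₁ : semistabilityIndex W₁ p = 2) (hsurj₁ : Surj W₁ p) {r₁ : ℕ}
    (hr₁ : r₁ ≤ W₁.mordellWeilRank) (hlcm : ¬ (p - 1) ∣ Nat.lcm (semistabilityIndex W p) 2)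
    (hT : TorsionIso W W₁ p)
    (S₀ : Finset (HeightOneSpectrum (𝓞 ℚ))) (hS₀ : ∀ w ∈ S₀, ((p : ℕ) : 𝓞 ℚ) ∉ w.asIdeal)
    (hS : ∀ w : HeightOneSpectrum (𝓞 ℚ), w ∉ S₀ → ((p : ℕ) : 𝓞 ℚ) ∉ w.asIdeal →
      W.HasGoodReductionAt w)
    (hS₁ : ∀ w : HeightOneSpectrum (𝓞 ℚ), w ∉ S₀ → ((p : ℕ) : 𝓞 ℚ) ∉ w.asIdeal →
      W₁.HasGoodReductionAt w)
    {b : ℕ} (hb : (b : ℤ) ≤ r₁ + ∑ w ∈ S₀, ((delta W₁ p w : ℤ) - (delta W p w : ℤ))) :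
    BudgetLeLambdaAt p W b :=
  hX.budgetLeLambdaAt_of_gv_of_gordTwoPartner_of_congr_of_not_dvd_lcm hGV hGrK hp5 hRD hX₁ he₁ hlcm hT S₀
    hS₀ hS hS₁
    (fun hκ hγ hγ' D₁ _ ↦
      hX₁.isTorsion_and_le_lambdaInvariant_of_katoHalf hK hmodD he₁ hsurj₁ hr₁ hκ hγ hγ' D₁) hb

/-- **X4♯(G-ord) receiver of ANY defect, X4(M) ∧ surj(p) partner of rank `≥ r₁` (`p ≥ 5`, off the
swap locus): the EPW-free Route-G budget**, mod the receiver's `hRD` | A40/A41 (§1 + g3's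
`ClassX4M.isTorsion_and_le_lambdaInvariant_of_katoHalf`). PER PAIR; nothing booked.
[cite: GreenbergVatsal2000, §2 Prop. (2.8) with Remark (2.9), Cor. (2.3), Prop. (2.4), pp. 26–27 (arXiv:math/9906215)]
[cite: Kato2004Asterisque, Thm. 17.4 (3) (p. 273)] [cite: SilvermanATAEC1994, Ch. V Thm. 5.3, Cor. 5.4] -/
theorem ClassX4Gord.budgetLeLambdaAt_of_gv_of_multPartner_of_rank_of_not_dvd_lcm
    (hGV : muLambdaAlg_transfer_of_torsionIso_potOrd_of_not_dvd_torsionOrder)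
    (hK : Wuthrich2014.kato_halfEigenCharIdeal_dvd_cyclotomicPrime_of_surjective)
    (hmodD : nonempty_modularParametrizationData)
    (hT40 : Silverman1994_thmV53_tateUniformisation.{0})
    (hT41 : Silverman1994_thmV53_corV54_tateUniformisation.{0}) (hp5 : 5 ≤ p)
    (hX : ClassX4Gord W p) (hRD : RamifiedLineKummerEqAt W p)
    (hX₁ : ClassX4M W₁ p) (hsurj₁ : Surj W₁ p) {r₁ : ℕ} (hr₁ : r₁ ≤ W₁.mordellWeilRank)
    (hlcm : ¬ (p - 1) ∣ Nat.lcm (semistabilityIndex W p) 2) (hT : TorsionIso W W₁ p)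
    (S₀ : Finset (HeightOneSpectrum (𝓞 ℚ))) (hS₀ : ∀ w ∈ S₀, ((p : ℕ) : 𝓞 ℚ) ∉ w.asIdeal)
    (hS : ∀ w : HeightOneSpectrum (𝓞 ℚ), w ∉ S₀ → ((p : ℕ) : 𝓞 ℚ) ∉ w.asIdeal →
      W.HasGoodReductionAt w)
    (hS₁ : ∀ w : HeightOneSpectrum (𝓞 ℚ), w ∉ S₀ → ((p : ℕ) : 𝓞 ℚ) ∉ w.asIdeal →
      W₁.HasGoodReductionAt w)
    {b : ℕ} (hb : (b : ℤ) ≤ r₁ + ∑ w ∈ S₀, ((delta W₁ p w : ℤ) - (delta W p w : ℤ))) :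
    BudgetLeLambdaAt p W b :=
  hX.budgetLeLambdaAt_of_gv_of_multPartner_of_congr_of_not_dvd_lcm hGV hT40 hT41 hp5 hRD hX₁ hlcm hT S₀
    hS₀ hS hS₁
    (fun hκ hγ hγ' D₁ _ ↦
      hX₁.isTorsion_and_le_lambdaInvariant_of_katoHalf hK hmodD hsurj₁ hr₁ hκ hγ hγ' D₁) hb

/-- **X3♯(G-ord) receiver of ANY defect, X3♯(G-ord) ∩ `I₀*` partner of rank `≥ r₁` (`p ≥ 5`, off the
swap locus) — NO partner certificate, NO schema hypothesis:** `BudgetLeLambdaAt p W b` from `hGV`,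
`hGrK`, `hW16`, `hmodD`, the receiver's `hRD`, a `TorsionIso` certificate, `Σ₀`, ONE census bit
`p ∤ #E(ℚ)_tors` and `r₁ ≤ rank E₁(ℚ)` (§1 + g6's
`ClassX3Gord.isTorsion_and_le_lambdaInvariant_of_wuthrichHalf`). PER PAIR; nothing booked.
[cite: GreenbergVatsal2000, §2 Prop. (2.8) with Remark (2.9), Cor. (2.3), Prop. (2.4), pp. 26–27 (arXiv:math/9906215)]
[cite: Wuthrich2014, Thm. 16 (p. 397)] [cite: GreenbergLNM1716, Prop. 4.14, §2 Props. 2.2, 2.4, §3 Lemma 3.1] -/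
theorem ClassX3Gord.budgetLeLambdaAt_of_gv_of_gordTwoPartner_of_rank_of_not_dvd_lcm
    (hGV : muLambdaAlg_transfer_of_torsionIso_potOrd_of_not_dvd_torsionOrder)
    (hGrK : imKummer_ge_strictCondition_goodOrdinary)
    (hW16 : Wuthrich2014.thm16_halfEigenCharIdeal_dvd_cyclotomicPrime)
    (hmodD : nonempty_modularParametrizationData) (hp5 : 5 ≤ p)
    (hX : ClassX3Gord W p) (hRD : RamifiedLineKummerEqAt W p)
    (hX₁ : ClassX3Gord W₁ p) (he₁ : semistabilityIndex W₁ p = 2) {r₁ : ℕ}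
    (hr₁ : r₁ ≤ W₁.mordellWeilRank) (hlcm : ¬ (p - 1) ∣ Nat.lcm (semistabilityIndex W p) 2)
    (htors : ¬ p ∣ W.torsionOrder) (hT : TorsionIso W W₁ p)
    (S₀ : Finset (HeightOneSpectrum (𝓞 ℚ))) (hS₀ : ∀ w ∈ S₀, ((p : ℕ) : 𝓞 ℚ) ∉ w.asIdeal)
    (hS : ∀ w : HeightOneSpectrum (𝓞 ℚ), w ∉ S₀ → ((p : ℕ) : 𝓞 ℚ) ∉ w.asIdeal →
      W.HasGoodReductionAt w)
    (hS₁ : ∀ w : HeightOneSpectrum (𝓞 ℚ), w ∉ S₀ → ((p : ℕ) : 𝓞 ℚ) ∉ w.asIdeal →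
      W₁.HasGoodReductionAt w)
    {b : ℕ} (hb : (b : ℤ) ≤ r₁ + ∑ w ∈ S₀, ((delta W₁ p w : ℤ) - (delta W p w : ℤ))) :
    BudgetLeLambdaAt p W b :=
  hX.budgetLeLambdaAt_of_gv_of_gordTwoPartner_of_congr_of_not_dvd_lcm hGV hGrK hp5 hRD hX₁ he₁ hlcm htors
    hT S₀ hS₀ hS hS₁
    (fun hκ hγ hγ' D₁ _ ↦
      hX₁.isTorsion_and_le_lambdaInvariant_of_wuthrichHalf hW16 hmodD (by omega) he₁ hr₁ hκ hγ hγ' D₁) hb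

/-- **X3♯(G-ord) receiver of ANY defect, X3♯(M) partner of rank `≥ r₁` (`p ≥ 5`, off the swap locus)
— NO partner certificate, NO schema hypothesis**, mod the receiver's `hRD` | A40/A41 (§1 + g6's
`ClassX3M.isTorsion_and_le_lambdaInvariant_of_wuthrichHalf`). PER PAIR; nothing booked.
[cite: GreenbergVatsal2000, §2 Prop. (2.8) with Remark (2.9), Cor. (2.3), Prop. (2.4), pp. 26–27 (arXiv:math/9906215)]
[cite: Wuthrich2014, Thm. 16 (p. 397)] [cite: SilvermanATAEC1994, Ch. V Thm. 5.3, Cor. 5.4] -/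
theorem ClassX3Gord.budgetLeLambdaAt_of_gv_of_multPartner_of_rank_of_not_dvd_lcm
    (hGV : muLambdaAlg_transfer_of_torsionIso_potOrd_of_not_dvd_torsionOrder)
    (hW16 : Wuthrich2014.thm16_halfEigenCharIdeal_dvd_cyclotomicPrime)
    (hmodD : nonempty_modularParametrizationData)
    (hT40 : Silverman1994_thmV53_tateUniformisation.{0})
    (hT41 : Silverman1994_thmV53_corV54_tateUniformisation.{0}) (hp5 : 5 ≤ p)
    (hX : ClassX3Gord W p) (hRD : RamifiedLineKummerEqAt W p)
    (hX₁ : ClassX3M W₁ p) {r₁ : ℕ} (hr₁ : r₁ ≤ W₁.mordellWeilRank)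
    (hlcm : ¬ (p - 1) ∣ Nat.lcm (semistabilityIndex W p) 2) (htors : ¬ p ∣ W.torsionOrder)
    (hT : TorsionIso W W₁ p)
    (S₀ : Finset (HeightOneSpectrum (𝓞 ℚ))) (hS₀ : ∀ w ∈ S₀, ((p : ℕ) : 𝓞 ℚ) ∉ w.asIdeal)
    (hS : ∀ w : HeightOneSpectrum (𝓞 ℚ), w ∉ S₀ → ((p : ℕ) : 𝓞 ℚ) ∉ w.asIdeal →
      W.HasGoodReductionAt w)
    (hS₁ : ∀ w : HeightOneSpectrum (𝓞 ℚ), w ∉ S₀ → ((p : ℕ) : 𝓞 ℚ) ∉ w.asIdeal →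
      W₁.HasGoodReductionAt w)
    {b : ℕ} (hb : (b : ℤ) ≤ r₁ + ∑ w ∈ S₀, ((delta W₁ p w : ℤ) - (delta W p w : ℤ))) :
    BudgetLeLambdaAt p W b :=
  hX.budgetLeLambdaAt_of_gv_of_multPartner_of_congr_of_not_dvd_lcm hGV hT40 hT41 hp5 hRD hX₁ hlcm htors hT
    S₀ hS₀ hS hS₁
    (fun hκ hγ hγ' D₁ _ ↦
      hX₁.isTorsion_and_le_lambdaInvariant_of_wuthrichHalf hW16 hmodD hr₁ hκ hγ hγ' D₁) hb

end Summit.BirchSwinnertonDyer.Rank1Residual.Additive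

end
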